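import Summits.QuantumFields.GaugeBoot.PolynomialOrbitAveraging
import Summits.QuantumFields.GaugeBoot.SquareSmoothing
import Summits.QuantumFields.GaugeBoot.BootstrapFunctionals
import HarnessLib

/-!
# The orbit-averaging operator on observables and on linear functionals (gauge-boot, L1 supplement)

HONEST FRAMING (cell `pub-gaugeboot`, page 1 of every file): the venture produces certified bounds
on lattice expectations at stated coupling, gauge group, dimension and torus size; NOT a mass gap,
NOT a continuum limit, NOT a string tension; NOT Yang–Mills-summit-bearing (barriers
`FixedCouplingUltralocality`, `PerturbativeInvisibility`). Structural; it certifies no number.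

## Content

For a compact group `H` acting jointly continuously on a compact space `Ω` (the gauge group on
the configurations, lattice symmetries, global conjugation) the ORBIT AVERAGE
`f ↦ ∫ f ∘ act h dh` as an `ℝ`-LINEAR OPERATOR `avgL act hact : C(Ω, ℝ) →ₗ[ℝ] C(Ω, ℝ)` (a
`C(Ω, ℝ)`-valued Bochner integral; pointwise it is `orbitAverage` of `GroupAveraging.lean`), and
its transpose `ψ ↦ ψ ∘ₗ avgL` on LINEAR functionals — the device by which a bootstrap written on
INVARIANT data only (`GaugeInvariantBootstrap.lean`) becomes a bootstrap on all polynomial data: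

* operator: `avgL_apply`, `avgL_of_invariant` (fixes invariant observables), `avgL_act` (its
  values are invariant), `avgL_comp_actCM` (absorbs the action), `avgL_avgL` (idempotent),
  `avgL_one`, `avgL_mul_of_invariant` (invariant factors come out), `avgL_nonneg`,
  `norm_avgL_le`; `avgL_mem_polyAlgebra` — on configuration spaces `ι → G` whose generators lie in
  finite-dimensional stable subspaces (`hgen`, e.g. the gauge actions, `GaugeOrbitPolynomials`)
  the polynomial observables are mapped into themselves;
* functionals (no continuity assumed): `comp_avgL_comp_actCM` — `ψ ∘ₗ avgL` is an invariant
  functional for EVERY linear `ψ`; `comp_avgL_eq_of_forall_invariant` — it only depends on the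
  values of `ψ` on invariant observables; ★ `apply_avgL_of_invariant` — an INVARIANT linear
  functional `φ` satisfies `φ (avgL f) = φ f` for `f` in any finitely generated stable subspace
  (automatic continuity in finite dimension; in particular for every polynomial observable,
  `apply_avgL_of_invariant_poly`): on the polynomials the invariant functionals are exactly the
  functionals `ψ ∘ₗ avgL`;
* states: `integral_avgL` — `∫ avgL f dμ = ∫ f d(avgMeasure μ)`; `integral_avgL_of_map_eq` /
  `expectationFunctional_comp_avgL` — an invariant state does not see the averaging.

References: folklore (Haar averaging / the Reynolds operator of a compact group action).
-/

noncomputable section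

open MeasureTheory
open Literature.MathematicalPhysics.QuantumFieldTheory (haarProbability LatticeRep)

namespace Summit.QuantumFields.GaugeBoot

variable {H : Type*} [Group H] [TopologicalSpace H] [IsTopologicalGroup H] [CompactSpace H]
  [MeasurableSpace H] [BorelSpace H]
variable {Ω : Type*} [TopologicalSpace Ω] [CompactSpace Ω] {act : H → Ω → Ω}

/-! ## The operator -/

section Operator

/-- `h ↦ f ∘ act h` is Haar-integrable in `C(Ω, ℝ)` (continuous on the compact group). -/
theorem integrable_comp_actCM (hact : Continuous fun p : H × Ω => act p.1 p.2) (f : C(Ω, ℝ)) :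
    Integrable (fun h => f.comp (actCM act hact h)) (haarProbability H) :=
  (continuous_comp_actCM hact f).integrable_of_hasCompactSupport
    (IsCompact.of_isClosed_subset isCompact_univ (isClosed_tsupport _) (Set.subset_univ _))

/-- **The orbit-averaging operator** `avgL act hact f = ∫ f ∘ act h dh` (normalised Haar measure of
the compact group `H`; a `C(Ω, ℝ)`-valued Bochner integral), an `ℝ`-linear self-map of the
observables. [folklore] -/
def avgL (act : H → Ω → Ω) (hact : Continuous fun p : H × Ω => act p.1 p.2) :
    C(Ω, ℝ) →ₗ[ℝ] C(Ω, ℝ) where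
  toFun f := ∫ h, f.comp (actCM act hact h) ∂haarProbability H
  map_add' f g := by
    have e : (fun h => (f + g).comp (actCM act hact h)) =
        fun h => f.comp (actCM act hact h) + g.comp (actCM act hact h) := rfl
    rw [e]
    exact integral_add (integrable_comp_actCM hact f) (integrable_comp_actCM hact g)
  map_smul' c f := by
    have e : (fun h => (c • f).comp (actCM act hact h)) = fun h => c • f.comp (actCM act hact h) := rfl
    rw [e, RingHom.id_apply]
    exact integral_smul c _

/-- `avgL` unfolded. -/
theorem avgL_def (hact : Continuous fun p : H × Ω => act p.1 p.2) (f : C(Ω, ℝ)) :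
    avgL act hact f = ∫ h, f.comp (actCM act hact h) ∂haarProbability H := rfl

/-- **Pointwise, `avgL` is the orbit average**: `(avgL f)(x) = ∫ f (act h x) dh`. [folklore] -/
@[simp] theorem avgL_apply (hact : Continuous fun p : H × Ω => act p.1 p.2) (f : C(Ω, ℝ)) (x : Ω) :
    avgL act hact f x = orbitAverage act f x := by
  have h := ((ContinuousMap.evalCLM ℝ x).integral_comp_comm (integrable_comp_actCM hact f)).symm
  simpa [avgL_def, orbitAverage] using h

/-- `⇑(avgL f) = orbitAverage act f`. -/
theorem coe_avgL (hact : Continuous fun p : H × Ω => act p.1 p.2) (f : C(Ω, ℝ)) :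
    ⇑(avgL act hact f) = orbitAverage act f :=
  funext (avgL_apply hact f)

/-- **`avgL` fixes the invariant observables.** [folklore] -/
theorem avgL_of_invariant (hact : Continuous fun p : H × Ω => act p.1 p.2) {f : C(Ω, ℝ)}
    (hf : ∀ h x, f (act h x) = f x) : avgL act hact f = f := by
  ext x
  rw [avgL_apply, orbitAverage_of_invariant hf]

/-- `avgL 1 = 1`. -/
@[simp] theorem avgL_one (hact : Continuous fun p : H × Ω => act p.1 p.2) : avgL act hact 1 = 1 :=
  avgL_of_invariant hact fun _ _ => rfl

/-- **The values of `avgL` are invariant observables** (right invariance of Haar measure).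
[folklore] -/
theorem avgL_act (hact : Continuous fun p : H × Ω => act p.1 p.2)
    (hmul : ∀ h h' x, act (h * h') x = act h (act h' x)) (f : C(Ω, ℝ)) (h' : H) (x : Ω) :
    avgL act hact f (act h' x) = avgL act hact f x := by
  rw [avgL_apply, avgL_apply, orbitAverage_act hmul]

/-- **`avgL` absorbs the action**: `avgL (f ∘ act h') = avgL f` (left invariance of Haar measure).
[folklore] -/
theorem avgL_comp_actCM (hact : Continuous fun p : H × Ω => act p.1 p.2)
    (hmul : ∀ h h' x, act (h * h') x = act h (act h' x)) (f : C(Ω, ℝ)) (h' : H) :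
    avgL act hact (f.comp (actCM act hact h')) = avgL act hact f := by
  ext x
  rw [avgL_apply, avgL_apply]
  exact congrFun (orbitAverage_comp_act hmul (⇑f) h') x

/-- **`avgL` is idempotent.** [folklore] -/
theorem avgL_avgL (hact : Continuous fun p : H × Ω => act p.1 p.2)
    (hmul : ∀ h h' x, act (h * h') x = act h (act h' x)) (f : C(Ω, ℝ)) :
    avgL act hact (avgL act hact f) = avgL act hact f :=
  avgL_of_invariant hact (avgL_act hact hmul f)

/-- **Invariant factors come out of the average**: `avgL (f w) = (avgL f) w` for invariant `w`
(the average is a conditional expectation onto the invariant observables). [folklore] -/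
theorem avgL_mul_of_invariant (hact : Continuous fun p : H × Ω => act p.1 p.2) (f : C(Ω, ℝ))
    {w : C(Ω, ℝ)} (hw : ∀ h x, w (act h x) = w x) :
    avgL act hact (f * w) = avgL act hact f * w := by
  ext x
  rw [avgL_apply, ContinuousMap.mul_apply, avgL_apply]
  exact congrFun (orbitAverage_mul_of_invariant (⇑f) hw) x

/-- `avgL (w f) = w (avgL f)` for invariant `w`. -/
theorem avgL_invariant_mul (hact : Continuous fun p : H × Ω => act p.1 p.2) (f : C(Ω, ℝ))
    {w : C(Ω, ℝ)} (hw : ∀ h x, w (act h x) = w x) :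
    avgL act hact (w * f) = w * avgL act hact f := by
  rw [mul_comm, avgL_mul_of_invariant hact f hw, mul_comm]

/-- **`avgL` is positive**: non-negative observables have non-negative averages. [folklore] -/
theorem avgL_nonneg (hact : Continuous fun p : H × Ω => act p.1 p.2) {f : C(Ω, ℝ)}
    (hf : ∀ x, 0 ≤ f x) (x : Ω) : 0 ≤ avgL act hact f x := by
  rw [avgL_apply]
  exact integral_nonneg fun h => hf _

/-- **`avgL` is a contraction** of the sup norm: `‖avgL f‖ ≤ ‖f‖`. [folklore] -/
theorem norm_avgL_le (hact : Continuous fun p : H × Ω => act p.1 p.2) (f : C(Ω, ℝ)) :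
    ‖avgL act hact f‖ ≤ ‖f‖ := by
  rw [avgL_def]
  refine (norm_integral_le_integral_norm _).trans ?_
  calc ∫ h, ‖f.comp (actCM act hact h)‖ ∂haarProbability H ≤ ∫ _h, ‖f‖ ∂haarProbability H :=
        integral_mono_of_nonneg (ae_of_all _ fun _ => norm_nonneg _) (integrable_const _)
          (ae_of_all _ fun h => norm_comp_le f _)
    _ = ‖f‖ := by simp

end Operator

/-! ## Polynomial observables on configuration spaces -/

section Poly

variable {ι : Type*} [Countable ι] {G : Type*} [Group G] [TopologicalSpace G] [IsTopologicalGroup G]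
  [CompactSpace G] [SecondCountableTopology G] (r : LatticeRep G) {actG : H → (ι → G) → (ι → G)}

/-- ★ **`avgL` maps the polynomial observables into themselves** whenever every generator lies in
a finite-dimensional stable subspace of the polynomial algebra (`hgen`; the gauge actions of the
torus and of `ℤ^d` qualify, `gaugeTransform_hgen` / `gaugeTransformZd_hgen`). [folklore] -/
theorem avgL_mem_polyAlgebra
    (hact : Continuous fun p : H × (ι → G) => actG p.1 p.2)
    (hgen : ∀ g ∈ entryGens (ι := ι) r, ∃ W : Submodule ℝ C(ι → G, ℝ), W.FG ∧
      W ≤ Subalgebra.toSubmodule (polyAlgebra (ι := ι) r) ∧ g ∈ W ∧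
      ∀ h : H, W.map (ContinuousMap.compRightAlgHom ℝ ℝ (actCM actG hact h)).toLinearMap ≤ W)
    {f : C(ι → G, ℝ)} (hf : f ∈ polyAlgebra (ι := ι) r) :
    avgL actG hact f ∈ polyAlgebra (ι := ι) r :=
  integral_comp_actCM_mem_polyAlgebra r hact hgen hf

end Poly

/-! ## Linear functionals -/

section Functionals

/-- **`ψ ∘ₗ avgL` is an invariant functional**, for every linear `ψ`. [folklore] -/
theorem comp_avgL_comp_actCM (hact : Continuous fun p : H × Ω => act p.1 p.2)
    (hmul : ∀ h h' x, act (h * h') x = act h (act h' x)) (ψ : C(Ω, ℝ) →ₗ[ℝ] ℝ) (f : C(Ω, ℝ))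
    (h' : H) : (ψ ∘ₗ avgL act hact) (f.comp (actCM act hact h')) = (ψ ∘ₗ avgL act hact) f := by
  simp only [LinearMap.comp_apply, avgL_comp_actCM hact hmul]

/-- `ψ ∘ₗ avgL` agrees with `ψ` on the invariant observables. -/
theorem comp_avgL_apply_of_invariant (hact : Continuous fun p : H × Ω => act p.1 p.2)
    (ψ : C(Ω, ℝ) →ₗ[ℝ] ℝ) {f : C(Ω, ℝ)} (hf : ∀ h x, f (act h x) = f x) :
    (ψ ∘ₗ avgL act hact) f = ψ f := by
  rw [LinearMap.comp_apply, avgL_of_invariant hact hf]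

/-- **`ψ ∘ₗ avgL` only depends on the values of `ψ` on invariant observables.** [folklore] -/
theorem comp_avgL_eq_of_forall_invariant (hact : Continuous fun p : H × Ω => act p.1 p.2)
    (hmul : ∀ h h' x, act (h * h') x = act h (act h' x)) {ψ₁ ψ₂ : C(Ω, ℝ) →ₗ[ℝ] ℝ}
    (h : ∀ g : C(Ω, ℝ), (∀ h x, g (act h x) = g x) → ψ₁ g = ψ₂ g) :
    ψ₁ ∘ₗ avgL act hact = ψ₂ ∘ₗ avgL act hact := by
  ext f
  exact h _ (avgL_act hact hmul f)

/-- ★ **An invariant linear functional does not see the averaging** on a finitely generated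
stable subspace `W`: `φ (avgL f) = φ f` for `f ∈ W` (no continuity of `φ` assumed: `φ` is
automatically continuous on the finite-dimensional `W`, which contains the whole integrand
`h ↦ f ∘ act h` and hence the Bochner average). [folklore] -/
theorem apply_avgL_of_invariant (hact : Continuous fun p : H × Ω => act p.1 p.2)
    (φ : C(Ω, ℝ) →ₗ[ℝ] ℝ) {W : Submodule ℝ C(Ω, ℝ)} (hWfg : W.FG)
    (hW : ∀ h : H, W.map (ContinuousMap.compRightAlgHom ℝ ℝ (actCM act hact h)).toLinearMap ≤ W)
    (hφ : ∀ h : H, ∀ g ∈ W, φ (g.comp (actCM act hact h)) = φ g)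
    {f : C(Ω, ℝ)} (hf : f ∈ W) : φ (avgL act hact f) = φ f := by
  obtain ⟨ψ, hψ⟩ := exists_clm_eqOn_of_fg φ hWfg
  haveI : FiniteDimensional ℝ W := (Submodule.fg_iff_finiteDimensional W).1 hWfg
  have hmem : ∀ h, f.comp (actCM act hact h) ∈ W := fun h => hW h (Submodule.mem_map_of_mem hf)
  have hint := integrable_comp_actCM hact f
  have havg : avgL act hact f ∈ W := by
    rw [avgL_def]
    exact W.convex.integral_mem W.closed_of_finiteDimensional (ae_of_all _ hmem) hint
  rw [← hψ _ havg, avgL_def, ← ψ.integral_comp_comm hint]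
  have e : ∀ h, ψ (f.comp (actCM act hact h)) = φ f := fun h => by
    rw [hψ _ (hmem h), hφ h f hf]
  simp [e]

variable {ι : Type*} {G : Type*} [Group G] [TopologicalSpace G] [CompactSpace G]
  (r : LatticeRep G) {actG : H → (ι → G) → (ι → G)}

/-- ★ **An invariant linear functional agrees with its own average on every polynomial
observable** (generators in finite-dimensional stable subspaces, `hgen`). So on the polynomial
observables the invariant linear functionals are exactly the functionals `ψ ∘ₗ avgL`. [folklore] -/
theorem apply_avgL_of_invariant_poly (hact : Continuous fun p : H × (ι → G) => actG p.1 p.2)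
    (hgen : ∀ g ∈ entryGens (ι := ι) r, ∃ W : Submodule ℝ C(ι → G, ℝ), W.FG ∧
      W ≤ Subalgebra.toSubmodule (polyAlgebra (ι := ι) r) ∧ g ∈ W ∧
      ∀ h : H, W.map (ContinuousMap.compRightAlgHom ℝ ℝ (actCM actG hact h)).toLinearMap ≤ W)
    (φ : C(ι → G, ℝ) →ₗ[ℝ] ℝ)
    (hφ : ∀ h : H, ∀ g ∈ polyAlgebra (ι := ι) r, φ (g.comp (actCM actG hact h)) = φ g)
    {f : C(ι → G, ℝ)} (hf : f ∈ polyAlgebra (ι := ι) r) : φ (avgL actG hact f) = φ f := by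
  obtain ⟨W, hWfg, hWle, hfW, hWinv⟩ := exists_fg_invariant_of_mem_polyAlgebra r hact hgen hf
  exact apply_avgL_of_invariant hact φ hWfg hWinv (fun h g hg => hφ h g (hWle hg)) hfW

end Functionals

/-! ## States -/

section States

variable [SecondCountableTopology H] [MeasurableSpace Ω] [BorelSpace Ω]

/-- **`∫ avgL f dμ = ∫ f d(avgMeasure μ)`**: averaging the observable = averaging the state.
[folklore] -/
theorem integral_avgL (hact : Continuous fun p : H × Ω => act p.1 p.2) (f : C(Ω, ℝ))
    (μ : Measure Ω) [IsFiniteMeasure μ] :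
    ∫ x, avgL act hact f x ∂μ = ∫ x, f x ∂avgMeasure act μ := by
  simp only [avgL_apply]
  exact (integral_avgMeasure hact f.continuous μ).symm

/-- **An invariant state does not see the averaging**: `∫ avgL f dμ = ∫ f dμ` when
`μ ∘ (act h)⁻¹ = μ` for all `h`. [folklore] -/
theorem integral_avgL_of_map_eq (hact : Continuous fun p : H × Ω => act p.1 p.2) (f : C(Ω, ℝ))
    (μ : Measure Ω) [IsFiniteMeasure μ] (hμ : ∀ h, μ.map (act h) = μ) :
    ∫ x, avgL act hact f x ∂μ = ∫ x, f x ∂μ := by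
  simp only [avgL_apply]
  exact integral_orbitAverage_eq_of_map_eq hact f.continuous μ hμ

variable {ι : Type*} [Countable ι] {G : Type*} [TopologicalSpace G] [CompactSpace G]
  [MeasurableSpace G] [BorelSpace G] [SecondCountableTopology G] {actG : H → (ι → G) → (ι → G)}

/-- **The expectation functional of an invariant state is its own average**:
`expectationFunctional μ ∘ₗ avgL = expectationFunctional μ`. [folklore] -/
theorem expectationFunctional_comp_avgL (hact : Continuous fun p : H × (ι → G) => actG p.1 p.2)
    (μ : Measure (ι → G)) [IsFiniteMeasure μ] (hμ : ∀ h, μ.map (actG h) = μ) :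
    expectationFunctional μ ∘ₗ avgL actG hact = expectationFunctional μ := by
  ext f
  rw [LinearMap.comp_apply, expectationFunctional_apply, expectationFunctional_apply]
  exact integral_avgL_of_map_eq hact f μ hμ

/-- The averaged expectation functional of ANY state is the expectation functional of the averaged
state: `(expectationFunctional μ ∘ₗ avgL) f = ∫ f d(avgMeasure μ)`. [folklore] -/
theorem expectationFunctional_comp_avgL_apply
    (hact : Continuous fun p : H × (ι → G) => actG p.1 p.2) (μ : Measure (ι → G))
    [IsFiniteMeasure μ] (f : C(ι → G, ℝ)) :
    (expectationFunctional μ ∘ₗ avgL actG hact) f = ∫ U, f U ∂avgMeasure actG μ := by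
  rw [LinearMap.comp_apply, expectationFunctional_apply]
  exact integral_avgL hact f μ

end States

end Summit.QuantumFields.GaugeBoot

end
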